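import Summits.BirchSwinnertonDyer.BirchSwinnertonDyer.Theorems.CMKolyvaginAtInertTwoEvaluationSurjectiveAtTwo
import Literature.NumberTheory.EllipticCurves.HeegnerPointsKolyvaginCebotarevProofs
import HarnessLib

/-!
# Route `CMKolyvaginAtInertTwo`, crux `CMKolyvaginExactAtInertTwo` (stmt-BirchSwinnertonDyer-24277):
# the Čebotarev leaf at `p = 2` with ARBITRARY TARGETS for a `σ_*`-closed family of classes
# (not only `τ`-invariant ones) — the form the `p = 2` DESCENT step (memo §2: classes `t`, `τt`,
# `δy_K`) will consume

Seat `bsd-line-cmk2-p1` g3 (cell `bsd-print-cf2`); helper (`--supports stmt-BirchSwinnertonDyer-24277`).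
THEOREMS ONLY: no definition, no named fact, no `sorry`; no item is closed; BSD is not proved by any
of this. Conditional on the Čebotarev density fact like the odd-`p` leaf.

WHAT. `…CebotarevLeafAtTwo.lean` (p597930) ports McCallum's Cor. 3.2 to `p = 2` for `τ`-INVARIANT
classes with prescriptions `N_i ∈ {0,1}`. The descent at `2` (the next, genuinely new step: one
depth-`1` Kolyvagin prime kills `(1+τ)·Sel₂(E/K)`, memo §2) works with classes that are NOT
`τ`-invariant (`t` and `τt = σ_* t`). For a family `(x_i)` CLOSED under `σ_*` (`σ_* x_i = x_{ι i}`)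
and independent mod `2`, Prop. 9.3 at `2` prescribes ALL values `[x_i, g] = e_i` at once, and then
the value at the Frobenius `τ' = g^τ g` of the Kolyvagin place is forced:
`[x_i, g^τ g] = τ e_{ι i} + e_i` (`IsLiftOfAut.h1Eval_conjAct`). Hence:

* `exists_kolyvaginPrime_gt_two_of_targets` — for `W/ℚ` with `ρ̄_{W,2}` onto, `K` imaginary
  quadratic with `Δ(W) ∉ K²`, `c ≠ 1`, a complex conjugation `c₀ ∈ Γ_ℚ` (fixing the lift
  `τ = e c₀ e⁻¹` of `c`), a `σ_*`-closed independent family `x_i` and targets `e_i ∈ E(K̄)[2]`: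
  Kolyvagin primes `ℓ > b` (Gross form, `FrobEqFrobInfty W K 2 ℓ` realised by `c₀ · res g`) with
  `x_{i,λ} = 0 ⟺ τ e_{ι i} + e_i = 0`. (No `Δ < 0` needed: the targets are the caller's.)

With `e_i ∈ {0, v}` (`τ v ≠ v`) and `ι = id` this is p597930's statement; with the family `(t, τt)`
and targets `(0, v)` it gives `t_λ ↔ τ v ≠ 0` and `(τt)_λ ↔ τ·0 + v = v ≠ 0`, the configuration of memo
§2. Steps C–H are again the odd-`p` proof verbatim.

References: [McCallumLMS1991] §3 Prop. 3.1, Cor. 3.2; [GrossLMS1991] §9; [TateGCFT1967] §2.4.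
-/

-- single-conjunct summit: `Summit.BirchSwinnertonDyer.BirchSwinnertonDyer.…` repeats the name by design
set_option linter.dupNamespace false
set_option autoImplicit false

noncomputable section

open scoped Classical Pointwise IntermediateField
open WeierstrassCurve NumberField IsDedekindDomain Field
open Literature.NumberTheory.GaloisRepresentations Literature.NumberTheory.EllipticCurves

namespace Summit.BirchSwinnertonDyer.BirchSwinnertonDyer.Theorems.KolyvaginImageTwo

/-- **The Čebotarev leaf at `p = 2` with arbitrary targets for a `σ_*`-closed family.** See the
module docstring: `ρ̄_{W,2}` onto, `[K:ℚ] = 2` imaginary, `Δ ∉ K²`, `c ≠ 1`, `c₀` a complex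
conjugation, `x_i` independent mod `2` with `σ_* x_i = x_{ι i}`, targets `e_i`; Kolyvagin primes
`ℓ > b` with `x_{i,λ} = 0 ⟺ τ e_{ι i} + e_i = 0`, `τ` the action of the lift `e c₀ e⁻¹` on
`E(K̄)[2]`. [cite: McCallumLMS1991, §3 Cor. 3.2 (proof, with Prop. 3.1)]
[cite: GrossLMS1991, §9 (Props. 9.3, 9.6 and the density argument)] -/
theorem exists_kolyvaginPrime_gt_two_of_targets (hC : Literature.NumberTheory.Automorphic.chebotarev_artinRep)
    {N : ℕ} [NeZero N] (W : WeierstrassCurve ℚ) [W.IsElliptic] {K : Type} [Field K] [NumberField K]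
    (hK : IsImaginaryQuadratic K) (hρ : W.HasSurjectiveModNGaloisRep 2)
    (hΔK : ¬ IsSquare (W.baseChange K).Δ) {c : K ≃ₐ[ℚ] K} (hc : c ≠ 1)
    {c₀ : absoluteGaloisGroup ℚ} (hc₀ : IsComplexConjugation (Rat.castHom ℝ) c₀)
    {r : ℕ} (cs : Fin r → galH1Torsion (W.baseChange K) ((2 : ℕ) : ℤ))
    (ι : Fin r → Fin r) (hτ : ∀ i, conjAct W c ((2 : ℕ) : ℤ) (cs i) = cs (ι i))
    (hind : ∀ a : Fin r → ℤ, ∑ i, a i • cs i = 0 → ∀ i, (((2 : ℕ) : ℕ) : ℤ) ∣ a i)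
    (e : Fin r → geomTorsion (W.baseChange K) ((2 : ℕ) : ℤ)) (b : ℕ) :
    ∃ ℓ : ℕ, b < ℓ ∧ ℓ.Prime ∧ ¬ ℓ ∣ N ∧ ¬ ((ℓ : ℤ) ∣ NumberField.discr K) ∧ ℓ ≠ 2 ∧
      (Ideal.span {(ℓ : 𝓞 K)}).IsPrime ∧ FrobEqFrobInfty W K 2 ℓ ∧
      ∀ i, ∀ v : HeightOneSpectrum (𝓞 K), (ℓ : 𝓞 K) ∈ v.asIdeal →
        (cs i ∈ (W.baseChange K).torsionLocalKer (v.adicCompletion K) ((2 : ℕ) : ℤ) ↔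
          (RatClosure.isLiftOfAut_absGaloisTransport_of_isImaginaryQuadratic hK hc hc₀).torsionMap
              W ((2 : ℕ) : ℤ) (e (ι i)) + e i = 0) := by
  classical
  have hp : Nat.Prime 2 := Nat.prime_two
  haveI : Algebra.IsQuadraticExtension ℚ K := ⟨hK.1⟩
  haveI : IsTotallyComplex K := hK.2
  have hp0 : ((2 : ℕ) : ℤ) ≠ 0 := by norm_num
  -- ### Step A: the involutive lift of `c` through the complex conjugation `c₀`
  set t : AlgebraicClosure K ≃+* AlgebraicClosure K :=
    (absGaloisTransport (K := ℚ) (L := K) c₀).toRingEquiv with ht_def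
  have ht : IsLiftOfAut c t :=
    RatClosure.isLiftOfAut_absGaloisTransport_of_isImaginaryQuadratic hK hc hc₀
  have hinv : ∀ x, t (t x) = x := fun x ↦
    RatClosure.absGaloisTransport_absGaloisTransport_of_sq_eq_one hc₀.sq_eq_one x
  -- `σ_*` is an involution on the family: `cs (ι (ι i)) = cs i`-free formulation via `h1Eval_conjAct`
  -- ### Step B (p = 2): the choice of `ρ` — Prop. 9.3 at `2` with the given targets
  obtain ⟨ρ, hρT, hρe⟩ := exists_h1Eval_eq_two W K hK.1 hρ hΔK cs hind e
  have hρ : ∀ m ∈ evalKer (W.baseChange K) ((2 : ℕ) : ℤ) cs, ∀ i,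
      h1Eval (W.baseChange K) ((2 : ℕ) : ℤ) (cs i) (ht.conjGalCMH (ρ * m) * (ρ * m)) = 0 ↔
        ht.torsionMap W ((2 : ℕ) : ℤ) (e (ι i)) + e i = 0 := by
    intro m hm i
    have hρm : ρ * m ∈ torsionFixing (W.baseChange K) ((2 : ℕ) : ℤ) := mul_mem hρT hm.1
    have hρm' := ht.conjGalCMH_mem_torsionFixing W hinv _ hρm
    -- `[cs i, (ρm)^τ] = τ [σ_* (cs i), ρm] = τ [cs (ι i), ρm] = τ e (ι i)`
    have hconj : h1Eval (W.baseChange K) ((2 : ℕ) : ℤ) (cs i) (ht.conjGalCMH (ρ * m)) =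
        ht.torsionMap W ((2 : ℕ) : ℤ) (e (ι i)) := by
      have h := ht.h1Eval_conjAct W ((2 : ℕ) : ℤ) (cs i) hρm
      rw [hτ i, h1Eval_mul _ _ _ hρT, hρe (ι i), hm.2 (ι i), add_zero] at h
      -- `h : e (ι i) = τ [cs i, (ρm)^τ]`; apply the involution `τ`
      have := congrArg (ht.torsionMap W ((2 : ℕ) : ℤ)) h
      rw [ht.torsionMap_torsionMap W hinv] at this
      exact this.symm
    have hval : h1Eval (W.baseChange K) ((2 : ℕ) : ℤ) (cs i) (ht.conjGalCMH (ρ * m) * (ρ * m)) =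
        ht.torsionMap W ((2 : ℕ) : ℤ) (e (ι i)) + e i := by
      rw [h1Eval_mul _ _ _ hρm', hconj, h1Eval_mul _ _ _ hρT, hρe i, hm.2 i, add_zero]
    rw [hval]
  -- ### Step C: the finite exceptional set of places of `ℚ`
  have hbad : ((W.baseChange K).badPlaces (𝓞 K)).Finite :=
    (W.baseChange K).finite_badPlaces_holds (𝓞 K)
  choose T hTfin hT using fun i ↦
    exists_finite_forall_mem_unramifiedKer (W.baseChange K) (n := ((2 : ℕ) : ℤ)) hp0 (cs i)
  set B : Finset ℕ := {2} ∪ N.primeFactors ∪ (NumberField.discr K).natAbs.primeFactors ∪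
    Finset.range (b + 1) with hB
  set S₁ : Set (HeightOneSpectrum (𝓞 ℚ)) := {v | ∃ q ∈ B, q.Prime ∧ (q : 𝓞 ℚ) ∈ v.asIdeal}
    with hS₁
  set S₂ : Set (HeightOneSpectrum (𝓞 ℚ)) := {v | ¬ Algebra.IsUnramifiedIn (𝓞 K) v.asIdeal}
    with hS₂
  set S₃ : Set (HeightOneSpectrum (𝓞 ℚ)) :=
    (fun w : HeightOneSpectrum (𝓞 K) ↦ w.under (𝓞 ℚ)) ''
      ((W.baseChange K).badPlaces (𝓞 K) ∪ ⋃ i, T i) with hS₃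
  have hS₁fin : S₁.Finite := by
    have : S₁ ⊆ ⋃ q ∈ (B.filter Nat.Prime), {v | (q : 𝓞 ℚ) ∈ v.asIdeal} := by
      intro v ⟨q, hqB, hq, hqv⟩
      simp only [Set.mem_iUnion, Finset.mem_filter]
      exact ⟨q, ⟨hqB, hq⟩, hqv⟩
    refine Set.Finite.subset (Set.Finite.biUnion (Finset.finite_toSet _) fun q hq ↦ ?_) this
    rw [Finset.coe_filter, Set.mem_setOf_eq] at hq
    have hsub : {v : HeightOneSpectrum (𝓞 ℚ) | (q : 𝓞 ℚ) ∈ v.asIdeal}.Subsingleton :=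
      fun v hv v' hv' ↦ HeightOneSpectrum.eq_of_natCast_mem_rat hq.2 hv hv'
    exact hsub.finite
  have hS₂fin : S₂.Finite := finite_setOf_not_isUnramifiedIn ℚ K
  have hS₃fin : S₃.Finite :=
    (hbad.union (Set.finite_iUnion fun i ↦ hTfin i)).image _
  set S := S₁ ∪ S₂ ∪ S₃ with hSdef
  have hSfin : S.Finite := (hS₁fin.union hS₂fin).union hS₃fin
  -- ### Step D: Čebotarev in `Γ_ℚ`: a Frobenius in the open set `c₀ · res(ρ 𝒩)`
  set 𝒩 := evalKer (W.baseChange K) ((2 : ℕ) : ℤ) cs with h𝒩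
  have h𝒩open : IsOpen (𝒩 : Set (absoluteGaloisGroup K)) :=
    isOpen_evalKer (W.baseChange K) ((2 : ℕ) : ℤ) cs (isOpen_torsionFixing (W.baseChange K) hp0)
  set O : Set (absoluteGaloisGroup ℚ) :=
    (fun γ ↦ c₀ * γ) '' (absGaloisRestrict ℚ K '' ((fun m ↦ ρ * m) '' (𝒩 : Set _))) with hO
  have hOopen : IsOpen O := by
    refine (Homeomorph.mulLeft c₀).isOpenMap _ (isOpenMap_absGaloisRestrict K _ ?_)
    exact (Homeomorph.mulLeft ρ).isOpenMap _ h𝒩open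
  have hOne : O.Nonempty :=
    ⟨c₀ * absGaloisRestrict ℚ K (ρ * 1), _, ⟨_, ⟨1, 𝒩.one_mem, rfl⟩, rfl⟩, rfl⟩
  obtain ⟨γ, hγO, v, hvS, 𝔓₀, h𝔓₀, hγ⟩ :=
    (absoluteGaloisGroup.frobenius_dense hC ℚ S hSfin).inter_open_nonempty O hOopen hOne
  obtain ⟨_, ⟨_, ⟨m, hm, rfl⟩, rfl⟩, rfl⟩ := hγO
  set g := ρ * m with hg
  have hgT : g ∈ torsionFixing (W.baseChange K) ((2 : ℕ) : ℤ) := mul_mem hρT hm.1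
  -- ### Step E: the rational prime `ℓ` under `v`
  obtain ⟨ℓ, hℓ, hℓv⟩ := exists_prime_natCast_mem v
  have hℓB : ℓ ∉ B := fun h ↦ hvS (Or.inl (Or.inl ⟨ℓ, h, hℓ, hℓv⟩))
  simp only [hB, Finset.mem_union, Finset.mem_singleton, Nat.mem_primeFactors,
    Finset.mem_range, not_or] at hℓB
  obtain ⟨⟨⟨hℓp, hℓN⟩, hℓD⟩, hℓb⟩ := hℓB
  have hℓN' : ¬ ℓ ∣ N := fun h ↦ hℓN ⟨hℓ, h, NeZero.ne N⟩
  have hℓD' : ¬ ((ℓ : ℤ) ∣ NumberField.discr K) := fun h ↦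
    hℓD ⟨hℓ, Int.natAbs_dvd_natAbs.mpr h |>.trans (by simp), by
      simp [NumberField.discr_ne_zero]⟩
  have hbℓ : b < ℓ := by omega
  have hunr : Algebra.IsUnramifiedIn (𝓞 K) v.asIdeal := by
    by_contra h; exact hvS (Or.inl (Or.inr h))
  have hvS₃ : v ∉ S₃ := fun h ↦ hvS (Or.inr h)
  -- ### Step F: `ℓ` is inert, with a Frobenius `τ' = g^τ g` over `K`
  have hHi := index_range_absGaloisRestrict_eq_finrank ℚ K
  haveI hHn : ((absGaloisRestrict ℚ K).range).Normal :=
    Subgroup.normal_of_index_eq_two (hHi.trans hK.1)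
  have hI := inertia_le_range_absGaloisRestrict_of_isUnramifiedIn (K := K) hunr h𝔓₀
  have hΦH : c₀ * absGaloisRestrict ℚ K g ∉ (absGaloisRestrict ℚ K).range := by
    intro h
    apply hc₀.not_mem_range_absGaloisRestrict (L := K) IsTotallyComplex.isComplex
    change c₀ ∈ ((absGaloisRestrict ℚ K).range : Set (absoluteGaloisGroup ℚ))
    have h' : c₀ = c₀ * absGaloisRestrict ℚ K g * (absGaloisRestrict ℚ K g)⁻¹ := by group
    rw [SetLike.mem_coe, h']
    exact Subgroup.mul_mem _ h (Subgroup.inv_mem _ ⟨g, rfl⟩)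
  obtain ⟨w, 𝔔, τ', hwv, hwuniq, -, h𝔔w, -, hτ', hresτ'⟩ :=
    exists_place_inert_of_not_mem_range (F := ℚ) (M := K) (hK.1 ▸ Nat.prime_two) hHn
      (hHi.trans rfl) hunr h𝔓₀ hI hγ hΦH
  rw [hK.1, sq_eq_absGaloisRestrict_conjGal_mul hc₀ ht g] at hresτ'
  have hτ'eq : τ' = ht.conjGalCMH g * g := absGaloisRestrict_injective ℚ K hresτ'
  -- `ℓ ∈ w`, and `w` is the only place of `K` containing `ℓ`
  have hℓw : (ℓ : 𝓞 K) ∈ w.asIdeal := by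
    have h1 : (ℓ : 𝓞 ℚ) ∈ (w.under (𝓞 ℚ)).asIdeal := by rw [hwv]; exact hℓv
    rw [HeightOneSpectrum.under_asIdeal, Ideal.under_def, Ideal.mem_comap, map_natCast] at h1
    exact h1
  have hwuniq' : ∀ w' : HeightOneSpectrum (𝓞 K), (ℓ : 𝓞 K) ∈ w'.asIdeal → w' = w := by
    intro w' hw'
    apply hwuniq
    apply HeightOneSpectrum.eq_of_natCast_mem_rat hℓ _ hℓv
    rw [HeightOneSpectrum.under_asIdeal, Ideal.under_def, Ideal.mem_comap, map_natCast]
    exact hw'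
  -- `(ℓ) = w` is prime
  have hspan : Ideal.span {(ℓ : 𝓞 K)} = w.asIdeal := by
    apply span_natCast_eq_of_unique hℓ w hwuniq'
    haveI : w.asIdeal.LiesOver v.asIdeal := ⟨by rw [← hwv]; rfl⟩
    have hmap : v.asIdeal.map (algebraMap (𝓞 ℚ) (𝓞 K)) = Ideal.span {(ℓ : 𝓞 K)} := by
      rw [← span_natCast_rat_eq hℓ hℓv, Ideal.map_span, Set.image_singleton, map_natCast]
    have hne : v.asIdeal.map (algebraMap (𝓞 ℚ) (𝓞 K)) ≠ ⊥ := by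
      rw [hmap, Ne, Ideal.span_singleton_eq_bot]; exact_mod_cast hℓ.ne_zero
    rw [← hmap, ← Ideal.IsDedekindDomain.ramificationIdx_eq_normalizedFactors_count v.asIdeal
      w.asIdeal hne]
    exact Ideal.ramificationIdx_eq_one_iff.mpr (hunr w.asIdeal w.isPrime inferInstance)
  -- ### Step G: the local criterion at `w`
  have hloc : ∀ i, (cs i ∈ (W.baseChange K).torsionLocalKer (w.adicCompletion K) ((2 : ℕ) : ℤ) ↔
      ht.torsionMap W ((2 : ℕ) : ℤ) (e (ι i)) + e i = 0) := by
    intro i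
    haveI : CharZero (w.adicCompletion K) :=
      charZero_of_injective_algebraMap (algebraMap K (w.adicCompletion K)).injective
    obtain ⟨𝔐, h𝔐⟩ := w.localPrimesAbove_nonempty
    set 𝔓w := w.primeBelow (closureEmb (K := K) (w.adicCompletion K)) 𝔐 with h𝔓w_def
    have h𝔓w : 𝔓w ∈ w.primesAbove := w.primeBelow_mem_primesAbove h𝔐
    obtain ⟨δ, hδ, hF⟩ :=
      HeightOneSpectrum.exists_isArithFrobAt_conj_of_mem_primesAbove_holds h𝔔w h𝔓w hτ'
    have hτ'T : τ' ∈ torsionFixing (W.baseChange K) ((2 : ℕ) : ℤ) := by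
      rw [hτ'eq]; exact mul_mem (ht.conjGalCMH_mem_torsionFixing W hinv _ hgT) hgT
    have hFT : δ * τ' * δ⁻¹ ∈ torsionFixing (W.baseChange K) ((2 : ℕ) : ℤ) :=
      (torsionFixing_normal (W.baseChange K) ((2 : ℕ) : ℤ)).conj_mem _ hτ'T δ
    have hwbad : w ∉ (W.baseChange K).badPlaces (𝓞 K) := fun h ↦
      hvS₃ ⟨w, Or.inl h, hwv⟩
    have hwT : w ∉ T i := fun h ↦ hvS₃ ⟨w, Or.inr (Set.mem_iUnion.mpr ⟨i, h⟩), hwv⟩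
    have hpw : ((((2 : ℕ) : ℤ)) : 𝓞 K) ∉ w.asIdeal := by
      rw [Int.cast_natCast]
      exact not_natCast_mem_of_prime_ne hℓ hp hℓp w hℓw
    have hcrit := mem_torsionLocalKer_iff_h1Eval_eq_zero (W.baseChange K) ((2 : ℕ) : ℤ) h𝔐 hF hFT
      (inertia_le_torsionFixing (W.baseChange K) hwbad hpw _ h𝔐)
      (isOpen_torsionFixing (W.baseChange K) hp0)
      (torsionPointsMap_bijective (W.baseChange K) (w.adicCompletion K) hp.ne_zero).2
      (hT i w hwT 𝔓w h𝔓w)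
    rw [hcrit, h1Eval_conj (W.baseChange K) ((2 : ℕ) : ℤ) (cs i) δ hτ'T, smul_eq_zero_iff_eq, hτ'eq]
    exact hρ m hm i
  -- ### Step H: assemble
  refine ⟨ℓ, hbℓ, hℓ, hℓN', hℓD', hℓp, hspan ▸ w.isPrime, ?_, fun i v' hv' ↦ ?_⟩
  · -- (3.2): `γ = c₀ · res g` acts on `E(ℚ̄)[p]` and on `K` as `c₀`
    refine ⟨v, 𝔓₀, c₀ * absGaloisRestrict ℚ K g, c₀, hℓv, h𝔓₀, hγ, hc₀, fun P ↦ ?_, fun e x ↦ ?_⟩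
    · rw [mul_smul, absGaloisRestrict_smul_eq_of_mem_torsionFixing W hgT]
    · rw [mul_smul, absGaloisRestrict_smul_apply_eq g e x]
  · rw [hwuniq' v' hv']
    exact hloc i


end Summit.BirchSwinnertonDyer.BirchSwinnertonDyer.Theorems.KolyvaginImageTwo

end
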